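import Summits.BirchSwinnertonDyer.BirchSwinnertonDyer.Theorems.ResidualThetaTransportAtTwoThetaLayerLambdaCongruenceAtTwoHeckeAdjointSweep
import HarnessLib

/-!
# Crux `ThetaLayerLambdaCongruenceAtTwo` (stmt-BirchSwinnertonDyer-20688, route ResidualThetaTransportAtTwo), line
# `birth` v14 — SD floor, kernel road, Hecke clause of IP, brick HA8b (part 3) «TRANSPOSED SWEEP»: the sweep identity in the exact
# matrix shapes of the assembled dual side (`u⁻¹·M̃_i`, `M̃_i` = w4 g7's transposed representatives `(p 0; −Nj 1)`, `(1 0; 0 p)`) and Manin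
# side (`adj(M_j)·u⁻¹`, `M_j = (1 j; 0 p)`, `(p 0; 0 1)`) (lead prover bsd-wall-rtt-p3 g13; `--supports stmt-BirchSwinnertonDyer-20688 --as helper`;
# closes nothing)

HONEST FRAMING. Two corollaries of `…HeckeAdjointSweep` (apply it to `Φ ∘ adj`); no definition; nothing about any curve or form is asserted;
BSD is not proved by any of this.

WHAT. For every `Φ : M₂(ℤ) → A` with finitely supported inner sums:
`Σ_j Σᶠ_{u ∈ Γ₀(N)} Φ(adj(1 j; 0 p)·u⁻¹) [+ Σᶠ_u Φ(adj(p 0; 0 1)·u⁻¹)] = Σ_j Σᶠ_{u ∈ Γ₀(N)} Φ(u⁻¹·(p 0; −Nj 1)) [+ Σᶠ_u Φ(u⁻¹·(1 0; 0 p))]`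
(`sum_finsum_adj_tpB_mul_inv_eq` for `p ∣ N` over `Fin p`; `sum_finsum_adj_rep_mul_inv_eq` for `p ∤ N` over `Option (Fin p)` with the
`Option.elim` representative families of `…HeckeAdjointHeckeCocycle(Transpose)`). Both sides are `Σᶠ_{A ∈ S_p(N)} Φ(adj A)`: the left one is
the Manin side «`F(g⁻¹·adj(M)·u⁻¹·γ) − F(g⁻¹·adj(M)·u⁻¹)`» of `…HeckeAdjointManinSide` summed over the representatives, the right one the dual
side «`F(g⁻¹u⁻¹α'γ) − F(g⁻¹u⁻¹α')`» of `…HeckeAdjointDualSide` with `α' = M̃`, so this is the last identification of the Hecke clause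
`B(T_p • x) y = B(x, T♯_p y)` (memo `Cruxes/…/Lines/birth-sd2-hecke-adjoint.md` §3, sweep).

References: [Shimura1971] §3.3, Prop. 3.36; [Merel1994] §1.2–1.3.
-/

set_option autoImplicit false

noncomputable section

-- justification: the `Summit.BirchSwinnertonDyer.BirchSwinnertonDyer.…` path repeats a component (route-file convention)
set_option linter.dupNamespace false

open scoped Classical MatrixGroups

open CongruenceSubgroup Matrix.SpecialLinearGroup ModularGroup
open Literature.NumberTheory.EllipticCurves.ModularForms

namespace Summit.BirchSwinnertonDyer.BirchSwinnertonDyer.Theorems.ThetaLayerLambdaCongruenceAtTwo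

section TransposedSweep

variable {N : ℕ} [NeZero N] {p : ℕ} {A : Type*} [AddCommMonoid A]

omit [NeZero N] in
/-- `adj(u·X) = adj(X)·u⁻¹` for `u ∈ Γ₀(N)` (as integer matrices). [folklore] -/
theorem adjugate_coe_mul (u : Gamma0 N) (X : Matrix (Fin 2) (Fin 2) ℤ) :
    (((u : SL(2, ℤ)) : Matrix (Fin 2) (Fin 2) ℤ) * X).adjugate = X.adjugate * (((u⁻¹ : Gamma0 N) : SL(2, ℤ)) : Matrix (Fin 2) (Fin 2) ℤ) := by
  rw [Matrix.adjugate_mul_distrib, Subgroup.coe_inv, coe_inv]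

omit [NeZero N] in
/-- `adj(X·u) = u⁻¹·adj(X)` for `u ∈ Γ₀(N)`. [folklore] -/
theorem adjugate_mul_coe (u : Gamma0 N) (X : Matrix (Fin 2) (Fin 2) ℤ) :
    (X * ((u : SL(2, ℤ)) : Matrix (Fin 2) (Fin 2) ℤ)).adjugate = (((u⁻¹ : Gamma0 N) : SL(2, ℤ)) : Matrix (Fin 2) (Fin 2) ℤ) * X.adjugate := by
  rw [Matrix.adjugate_mul_distrib, Subgroup.coe_inv, coe_inv]

omit [NeZero N] in
/-- `adj(1 0; Nj p) = (p 0; −Nj 1)` and `adj(p 0; 0 1) = (1 0; 0 p)`: the adjugates of the right-sweep representatives are the transposed Hecke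
representatives of `…HeckeAdjointHeckeCocycleTranspose`. [folklore] -/
theorem adjugate_lowB_tpD (j p' : ℤ) :
    (!![1, 0; (N : ℤ) * j, p'] : Matrix (Fin 2) (Fin 2) ℤ).adjugate = !![p', 0; -((N : ℤ) * j), 1] ∧
    (!![p', 0; 0, 1] : Matrix (Fin 2) (Fin 2) ℤ).adjugate = !![1, 0; 0, p'] := by
  constructor <;> (rw [Matrix.adjugate_fin_two]; ext i k; fin_cases i <;> fin_cases k <;> simp)

/-- **TRANSPOSED SWEEP, `p ∣ N`.** For every `Φ : M₂(ℤ) → A` with finitely supported inner sums: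
`Σ_{j<p} Σᶠ_{u ∈ Γ₀(N)} Φ(adj(1 j; 0 p)·u⁻¹) = Σ_{j<p} Σᶠ_{u ∈ Γ₀(N)} Φ(u⁻¹·(p 0; −Nj 1))` (apply `sum_finsum_mul_tpB_eq_sum_finsum_lowB_mul` to
`Φ ∘ adj`). [cite: Shimura1971, Prop. 3.36] [cite: Merel1994, §1.2–1.3] -/
theorem sum_finsum_adj_tpB_mul_inv_eq (hp : p.Prime) (hpN : p ∣ N) (Φ : Matrix (Fin 2) (Fin 2) ℤ → A)
    (hL : ∀ j : Fin p, (Function.support fun u : Gamma0 N ↦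
      Φ ((!![1, ((j : ℕ) : ℤ); 0, (p : ℤ)] : Matrix (Fin 2) (Fin 2) ℤ).adjugate * (((u⁻¹ : Gamma0 N) : SL(2, ℤ)) : Matrix (Fin 2) (Fin 2) ℤ))).Finite)
    (hR : ∀ j : Fin p, (Function.support fun u : Gamma0 N ↦
      Φ ((((u⁻¹ : Gamma0 N) : SL(2, ℤ)) : Matrix (Fin 2) (Fin 2) ℤ) * !![(p : ℤ), 0; -((N : ℤ) * ((j : ℕ) : ℤ)), 1])).Finite) :
    ∑ j : Fin p, ∑ᶠ u : Gamma0 N,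
        Φ ((!![1, ((j : ℕ) : ℤ); 0, (p : ℤ)] : Matrix (Fin 2) (Fin 2) ℤ).adjugate * (((u⁻¹ : Gamma0 N) : SL(2, ℤ)) : Matrix (Fin 2) (Fin 2) ℤ)) =
      ∑ j : Fin p, ∑ᶠ u : Gamma0 N,
        Φ ((((u⁻¹ : Gamma0 N) : SL(2, ℤ)) : Matrix (Fin 2) (Fin 2) ℤ) * !![(p : ℤ), 0; -((N : ℤ) * ((j : ℕ) : ℤ)), 1]) := by
  have key := sum_finsum_mul_tpB_eq_sum_finsum_lowB_mul (N := N) hp hpN (Φ ∘ Matrix.adjugate) ?_ ?_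
  · simp only [Function.comp_apply, adjugate_coe_mul, adjugate_mul_coe, (adjugate_lowB_tpD (N := N) _ _).1] at key
    exact key
  · intro j
    simp only [Function.comp_apply, adjugate_coe_mul]
    exact hL j
  · intro j
    simp only [Function.comp_apply, adjugate_mul_coe, (adjugate_lowB_tpD (N := N) _ _).1]
    exact hR j

/-- **TRANSPOSED SWEEP, `p ∤ N`** (index `Option (Fin p)`; Manin-side representatives `i.elim (p 0; 0 1) (j ↦ (1 j; 0 p))`, dual-side
transposed representatives `i.elim (1 0; 0 p) (j ↦ (p 0; −Nj 1))` exactly as in `exists_heckeCocycle_option` /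
`exists_transposeHeckeCocycle_option`): `Σ_i Σᶠ_u Φ(adj(M_i)·u⁻¹) = Σ_i Σᶠ_u Φ(u⁻¹·M̃_i)`. [cite: DiamondShurman2005, §5.2] [cite: Merel1994, §1.2–1.3] -/
theorem sum_finsum_adj_rep_mul_inv_eq (hp : p.Prime) (hpN : ¬ p ∣ N) (Φ : Matrix (Fin 2) (Fin 2) ℤ → A)
    (hL : ∀ i : Option (Fin p), (Function.support fun u : Gamma0 N ↦
      Φ ((i.elim !![(p : ℤ), 0; 0, 1] fun j ↦ !![(1 : ℤ), ((j : ℕ) : ℤ); 0, (p : ℤ)]).adjugate *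
        (((u⁻¹ : Gamma0 N) : SL(2, ℤ)) : Matrix (Fin 2) (Fin 2) ℤ))).Finite)
    (hR : ∀ i : Option (Fin p), (Function.support fun u : Gamma0 N ↦
      Φ ((((u⁻¹ : Gamma0 N) : SL(2, ℤ)) : Matrix (Fin 2) (Fin 2) ℤ) *
        (i.elim !![(1 : ℤ), 0; 0, (p : ℤ)] fun j ↦ !![(p : ℤ), 0; -((N : ℤ) * ((j : ℕ) : ℤ)), 1]))).Finite) :
    ∑ i : Option (Fin p), ∑ᶠ u : Gamma0 N,
        Φ ((i.elim !![(p : ℤ), 0; 0, 1] fun j ↦ !![(1 : ℤ), ((j : ℕ) : ℤ); 0, (p : ℤ)]).adjugate *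
          (((u⁻¹ : Gamma0 N) : SL(2, ℤ)) : Matrix (Fin 2) (Fin 2) ℤ)) =
      ∑ i : Option (Fin p), ∑ᶠ u : Gamma0 N,
        Φ ((((u⁻¹ : Gamma0 N) : SL(2, ℤ)) : Matrix (Fin 2) (Fin 2) ℤ) *
          (i.elim !![(1 : ℤ), 0; 0, (p : ℤ)] fun j ↦ !![(p : ℤ), 0; -((N : ℤ) * ((j : ℕ) : ℤ)), 1])) := by
  -- adjugates of the `Option.elim` families, pointwise in `i`
  have hadjL : ∀ (i : Option (Fin p)) (u : Gamma0 N),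
      ((((u : SL(2, ℤ)) : Matrix (Fin 2) (Fin 2) ℤ) * (i.elim !![(p : ℤ), 0; 0, 1] fun j ↦ !![(1 : ℤ), ((j : ℕ) : ℤ); 0, (p : ℤ)]))).adjugate =
        (i.elim !![(p : ℤ), 0; 0, 1] fun j ↦ !![(1 : ℤ), ((j : ℕ) : ℤ); 0, (p : ℤ)]).adjugate *
          (((u⁻¹ : Gamma0 N) : SL(2, ℤ)) : Matrix (Fin 2) (Fin 2) ℤ) := fun i u ↦ adjugate_coe_mul u _
  have hadjR : ∀ (i : Option (Fin p)) (u : Gamma0 N),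
      ((i.elim !![(p : ℤ), 0; 0, 1] fun j ↦ !![1, 0; (N : ℤ) * ((j : ℕ) : ℤ), (p : ℤ)]) * ((u : SL(2, ℤ)) : Matrix (Fin 2) (Fin 2) ℤ)).adjugate =
        (((u⁻¹ : Gamma0 N) : SL(2, ℤ)) : Matrix (Fin 2) (Fin 2) ℤ) *
          (i.elim !![(1 : ℤ), 0; 0, (p : ℤ)] fun j ↦ !![(p : ℤ), 0; -((N : ℤ) * ((j : ℕ) : ℤ)), 1]) := by
    intro i u
    rw [adjugate_mul_coe]
    cases i with
    | none => dsimp only [Option.elim]; rw [(adjugate_lowB_tpD (N := N) 0 _).2]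
    | some j => dsimp only [Option.elim]; rw [(adjugate_lowB_tpD (N := N) _ _).1]
  have key := sum_finsum_mul_rep_eq_sum_finsum_rep_mul (N := N) hp hpN (Φ ∘ Matrix.adjugate) ?_ ?_
  · simp only [Function.comp_apply, hadjL, hadjR] at key
    exact key
  · intro i
    simp only [Function.comp_apply, hadjL]
    exact hL i
  · intro i
    simp only [Function.comp_apply, hadjR]
    exact hR i

end TransposedSweep

end Summit.BirchSwinnertonDyer.BirchSwinnertonDyer.Theorems.ThetaLayerLambdaCongruenceAtTwo

end
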